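import Mathlib
import Summits.Ventures.PercRepro2.StepZeroOfAS3

/-!
# Reimer per explored cluster: the fibre slot bound
(seat mine-b, cell pub-perc-repro2; conjectures/MINE-B.md §17)

Fix a pattern `(O, Y)` (pins `O` open in both colours, `Y` split blue / red), terminals `s`, `t`, and
a vertex set `S ∋ s`, `∌ t` that no pin crosses.  Split the free edges into the ones inside `S`, the
cut `C = δ(S)` and the outside ones; fix the inside colouring (`ζ` = the blue inside edges) and let `U`
be the cube of the remaining free edges (cut + outside).  This is the **fibre** `(S, ζ)` of the
exploration of the red cluster of `s`: when `S` is red-connected inside, the configurations of the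
fibre with `F_R = 0` are exactly those with the whole cut blue, and the ones with `F_R = 1` through a
red cut edge `e` are those with `C ∖ {e}` blue and a red path from `S` to `t` (`slot_cut_edge_red`).

**`fibre_slot_bound`**: on every fibre, for every `j`,
  `#{γ ⊆ U : C ⊆ γ ∧ F_B ≥ j+1} ≤ #{γ ⊆ U : C ∖ {e} ⊆ γ for some e ∈ C, F_B ≥ j, and O ∪ (U ∖ γ) carries some vertex of S to t}`
— Reimer's inequality for increasing events (`reimer_increasing`) on the cube `U` with
`A = {F_B ≥ j} ∩ {C minus one edge blue}` and `B = {a path from S to t}`: a source carries `j+1`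
disjoint blue `s–t` witnesses; `j` of them (their `U`-parts) together with `C ∖ {e}` witness `A`, the
`U`-part of the tail of the last one — after its last crossing edge `e` of `S`
(`exists_crossing_of_walk`) — witnesses `B`, and the two witnesses are disjoint.

Reading (MINE-B.md §17.1): the slots of the fibre `(S, ζ)` are the STEP(0, j+1) targets that have a
red `Y`-bridge with `s`-side exactly `S`; a target with `k` red bridges is a slot of `k` fibres.  So
summing the bound over the fibres gives `#{F_R = 0 ∧ F_B ≥ j+1} ≤ Σ_{targets} k(γ')` — the fibre
decomposition of the exploration lens reaches STEP(0, j+1) only up to the multiplicity `k`, and the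
per-fibre bound is the most a per-cluster Reimer argument can give (the `1/k`-capacity refinement is
false at `n = 6`, MINE-B.md §17.1).
-/

open Finset

namespace Summit.Ventures.PercRepro2

namespace StepZero

open ReimerCube

variable {V : Type*} {E : Type*} [DecidableEq E]

/-- the edge `e` crosses the vertex set `S`: one endpoint in `S`, the other outside -/
def Crosses (ends : E → Sym2 V) (S : Set V) (e : E) : Prop :=
  ∃ u v, ends e = s(u, v) ∧ u ∈ S ∧ v ∉ S

/-- the edge `e` lies outside `S`: no endpoint in `S` -/
def Outside (ends : E → Sym2 V) (S : Set V) (e : E) : Prop := ∀ x ∈ ends e, x ∉ S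

omit [DecidableEq E] in
/-- a crossing edge is not an outside edge -/
lemma not_outside_of_crosses {ends : E → Sym2 V} {S : Set V} {e : E} (h : Crosses ends S e) :
    ¬ Outside ends S e := by
  obtain ⟨u, v, he, hu, _⟩ := h
  intro hout
  exact hout u (by rw [he]; exact Sym2.mem_mk_left u v) hu

omit [DecidableEq E] in
/-- an edge with both endpoints in `S` does not cross `S` -/
lemma not_crosses_of_inside {ends : E → Sym2 V} {S : Set V} {e : E}
    (h : ∀ x ∈ ends e, x ∈ S) : ¬ Crosses ends S e := by
  rintro ⟨u, v, he, _, hv⟩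
  exact hv (h v (by rw [he]; exact Sym2.mem_mk_right u v))

omit [DecidableEq E] in
/-- an edge with both endpoints in `S` is not an outside edge -/
lemma not_outside_of_inside {ends : E → Sym2 V} {S : Set V} {e : E}
    (h : ∀ x ∈ ends e, x ∈ S) : ¬ Outside ends S e := by
  intro hout
  obtain ⟨a, b, hab⟩ : ∃ a b, ends e = s(a, b) :=
    Sym2.ind (f := fun i => ∃ a b, i = s(a, b)) (fun a b => ⟨a, b, rfl⟩) (ends e)
  exact hout a (by rw [hab]; exact Sym2.mem_mk_left a b) (h a (by rw [hab]; exact Sym2.mem_mk_left a b))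

open Classical in
/-- **The first crossing edge seen from outside.**  A walk of open `K`-edges from a vertex `z ∉ S` to a
vertex `x ∈ S` contains a crossing edge `e` of `S` such that `e` together with the outside edges of `K`
carries the `S`-endpoint of `e` to `z` (the part of the walk before its first entry into `S`). -/
lemma exists_crossing_of_walk (ends : E → Sym2 V) (S : Set V) (K : Finset E) :
    ∀ {z x : V}, (openGraph ends (ofFinset K)).Walk z x → z ∉ S → x ∈ S →
      ∃ e ∈ K, Crosses ends S e ∧ ∃ u ∈ S,
        Carries ends (insert e (K.filter (fun f => Outside ends S f))) u z := by
  intro z x w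
  induction w with
  | nil =>
    intro hz hx
    exact absurd hx hz
  | @cons z y x hadj _ ih =>
    intro hz hx
    rw [openGraph_adj] at hadj
    obtain ⟨_, e', he'open, he'ends⟩ := hadj
    have he'K : e' ∈ K := ofFinset_eq_true_iff.1 he'open
    by_cases hy : y ∈ S
    · refine ⟨e', he'K, ⟨y, z, by rw [he'ends, Sym2.eq_swap], hy, hz⟩, y, hy, ?_⟩
      apply conn_of_openAdj
      exact ⟨e', ofFinset_eq_true_iff.2 (Finset.mem_insert_self _ _), by rw [he'ends, Sym2.eq_swap]⟩
    · obtain ⟨e, heK, hcross, u, hu, hconn⟩ := ih hy hx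
      refine ⟨e, heK, hcross, u, hu, ?_⟩
      have hout : Outside ends S e' := by
        intro v hv
        rw [he'ends] at hv
        rcases Sym2.mem_iff.1 hv with rfl | rfl
        · exact hz
        · exact hy
      have hadj' : OpenAdj ends (ofFinset (insert e (K.filter (fun f => Outside ends S f)))) y z :=
        ⟨e', ofFinset_eq_true_iff.2 (Finset.mem_insert_of_mem (Finset.mem_filter.2 ⟨he'K, hout⟩)),
          by rw [he'ends, Sym2.eq_swap]⟩
      exact conn_trans hconn (conn_of_openAdj hadj')

open Classical in
/-- a carrying set from `s ∈ S` to `t ∉ S` contains a crossing edge `e` of `S` such that `e` and the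
outside edges of the set carry some vertex of `S` to `t` -/
lemma exists_crossing_of_carries (ends : E → Sym2 V) (S : Set V) {s t : V} (hs : s ∈ S) (ht : t ∉ S)
    {K : Finset E} (hK : Carries ends K s t) :
    ∃ e ∈ K, Crosses ends S e ∧ ∃ u ∈ S,
      Carries ends (insert e (K.filter (fun f => Outside ends S f))) u t := by
  obtain ⟨w⟩ := (conn_symm hK : Conn ends (ofFinset K) t s)
  exact exists_crossing_of_walk ends S K w ht hs

open Classical in
/-- **Reimer per explored cluster (the fibre slot bound).**  `S ∋ s`, `∌ t` is crossed by no pin of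
`O`; `ζ` are edges inside `S` (the blue inside edges of the fibre); `U` is a set of free edges
disjoint from `O` and `ζ` (in the fibre: the cut and the outside edges); `C = U.filter (Crosses ends S)`
is the cut.
Then for every `j`
  `#{γ ⊆ U : C ⊆ γ ∧ F_B(O ∪ ζ ∪ γ) ≥ j+1}`
    `≤ #{γ ⊆ U : (∃ e ∈ C, C ∖ {e} ⊆ γ) ∧ F_B(O ∪ ζ ∪ γ) ≥ j ∧ O ∪ (U ∖ γ) carries S to t}`. -/
theorem fibre_slot_bound (ends : E → Sym2 V) (s t : V) (O ζ U : Finset E) (S : Set V)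
    (hs : s ∈ S) (ht : t ∉ S)
    (hO : ∀ e ∈ O, ¬ Crosses ends S e)
    (hζ : ∀ e ∈ ζ, ∀ x ∈ ends e, x ∈ S)
    (hUO : Disjoint U O) (hUζ : Disjoint U ζ) (j : ℕ) :
    (U.powerset.filter (fun γ => U.filter (Crosses ends S) ⊆ γ ∧
        pinFlow ends s t (O ∪ ζ) (j + 1) γ)).card
      ≤ (U.powerset.filter (fun γ =>
          ((∃ e ∈ U.filter (Crosses ends S), U.filter (Crosses ends S) \ {e} ⊆ γ) ∧
            pinFlow ends s t (O ∪ ζ) j γ) ∧ ∃ u ∈ S, Carries ends (O ∪ (U \ γ)) u t)).card := by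
  set C := U.filter (Crosses ends S) with hCdef
  let A : Finset E → Prop := fun T => (∃ e ∈ C, C \ {e} ⊆ T) ∧ pinFlow ends s t (O ∪ ζ) j T
  let B : Finset E → Prop := fun T => ∃ u ∈ S, Carries ends (O ∪ T) u t
  have hA : Incr A := by
    rintro T T' hTT' ⟨⟨e, he, hCe⟩, hflow⟩
    exact ⟨⟨e, he, hCe.trans hTT'⟩, incr_pinFlow ends s t (O ∪ ζ) j hTT' hflow⟩
  have hB : Incr B := by
    rintro T T' hTT' ⟨u, hu, hcar⟩
    exact ⟨u, hu, hcar.mono (Finset.union_subset_union_right hTT')⟩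
  -- every source is a disjoint occurrence of `A` and `B`
  have key : ∀ γ ∈ U.powerset, C ⊆ γ → pinFlow ends s t (O ∪ ζ) (j + 1) γ → DOcc A B γ := by
    intro γ hγU hCγ hflow
    rw [Finset.mem_powerset] at hγU
    obtain ⟨K, L, hK, hL, hKL, hKc, hLk⟩ := hflow
    have hKst : Carries ends K s t := hKc K le_rfl
    obtain ⟨e, heK, hcross, u, hu, htail⟩ := exists_crossing_of_carries ends S hs ht hKst
    -- the crossing edge `e` is a free cut edge of the cube
    have heγ : e ∈ γ := by
      rcases Finset.mem_union.1 (hK heK) with h1 | h1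
      · rcases Finset.mem_union.1 h1 with h2 | h2
        · exact absurd hcross (hO e h2)
        · exact absurd hcross (not_crosses_of_inside (hζ e h2))
      · exact h1
    have heC : e ∈ C := Finset.mem_filter.2 ⟨hγU heγ, hcross⟩
    -- the two witnesses
    refine ⟨(L ∩ U) ∪ (C \ {e}), (insert e (K.filter (fun f => Outside ends S f))) ∩ γ,
      ?_, Finset.inter_subset_right, ?_, ?_, ?_⟩
    · -- `K' ⊆ γ`
      apply Finset.union_subset
      · intro f hf
        rw [Finset.mem_inter] at hf
        rcases Finset.mem_union.1 (hL hf.1) with h1 | h1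
        · rcases Finset.mem_union.1 h1 with h2 | h2
          · exact absurd h2 (Finset.disjoint_left.1 hUO hf.2)
          · exact absurd h2 (Finset.disjoint_left.1 hUζ hf.2)
        · exact h1
      · exact Finset.sdiff_subset.trans hCγ
    · -- disjointness of the witnesses
      rw [Finset.disjoint_left]
      intro f hf hf'
      rw [Finset.mem_inter, Finset.mem_insert] at hf'
      rcases Finset.mem_union.1 hf with h1 | h1
      · -- `f ∈ L`, but `f = e ∈ K` or `f ∈ K`
        have hfK : f ∈ K := by
          rcases hf'.1 with rfl | h2
          · exact heK
          · exact (Finset.mem_filter.1 h2).1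
        exact Finset.disjoint_left.1 hKL hfK (Finset.mem_inter.1 h1).1
      · rw [Finset.mem_sdiff, Finset.mem_singleton] at h1
        rcases hf'.1 with rfl | h2
        · exact h1.2 rfl
        · exact not_outside_of_crosses (Finset.mem_filter.1 h1.1).2 (Finset.mem_filter.1 h2).2
    · -- `A` on every superset of `K'`
      intro T hT
      refine ⟨⟨e, heC, Finset.subset_union_right.trans hT⟩, ?_⟩
      apply hLk
      intro f hf
      rcases Finset.mem_union.1 (hL hf) with h1 | h1
      · exact Finset.mem_union_left _ h1
      · exact Finset.mem_union_right _ (hT (Finset.mem_union_left _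
          (Finset.mem_inter.2 ⟨hf, hγU h1⟩)))
    · -- `B` on every superset of `L'`
      intro T hT
      refine ⟨u, hu, htail.mono ?_⟩
      intro f hf
      by_cases hfγ : f ∈ γ
      · exact Finset.mem_union_right _ (hT (Finset.mem_inter.2 ⟨hf, hfγ⟩))
      · have hfK : f ∈ K := by
          rcases Finset.mem_insert.1 hf with rfl | h2
          · exact heK
          · exact (Finset.mem_filter.1 h2).1
        rcases Finset.mem_union.1 (hK hfK) with h1 | h1
        · rcases Finset.mem_union.1 h1 with h2 | h2
          · exact Finset.mem_union_left _ h2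
          · -- an inside edge is neither `e` nor outside
            exfalso
            rcases Finset.mem_insert.1 hf with rfl | h3
            · exact not_crosses_of_inside (hζ f h2) hcross
            · exact not_outside_of_inside (hζ f h2) (Finset.mem_filter.1 h3).2
        · exact absurd h1 hfγ
  calc (U.powerset.filter (fun γ => C ⊆ γ ∧ pinFlow ends s t (O ∪ ζ) (j + 1) γ)).card
      ≤ (U.powerset.filter (fun γ => DOcc A B γ)).card := by
        apply Finset.card_le_card
        intro γ hγ
        have hγ' := Finset.mem_filter.1 hγ
        exact Finset.mem_filter.2 ⟨hγ'.1, key γ hγ'.1 hγ'.2.1 hγ'.2.2⟩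
    _ ≤ (U.powerset.filter (fun γ => A γ ∧ B (U \ γ))).card := by
        convert reimer_increasing U A B hA hB using 3

open Classical in
/-- in a slot of the fibre the witnessing cut edge is red: if the whole cut were blue, the red path
from `S` to `t` would have to cross `S` through a pin or a blue edge -/
lemma slot_cut_edge_red (ends : E → Sym2 V) (t : V) (O U : Finset E) (S : Set V) (ht : t ∉ S)
    (hO : ∀ e ∈ O, ¬ Crosses ends S e) {γ : Finset E}
    (hpath : ∃ u ∈ S, Carries ends (O ∪ (U \ γ)) u t) :
    ¬ U.filter (Crosses ends S) ⊆ γ := by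
  intro hC
  obtain ⟨u, hu, hcar⟩ := hpath
  obtain ⟨e, he, hcross, _⟩ := exists_crossing_of_carries ends S hu ht hcar
  rcases Finset.mem_union.1 he with h1 | h1
  · exact hO e h1 hcross
  · rw [Finset.mem_sdiff] at h1
    exact h1.2 (hC (Finset.mem_filter.2 ⟨h1.1, hcross⟩))


-- ===== FibreSlots =====


/-- **a cut with a single available crossing edge carries at most one disjoint path**: if every
crossing edge of `S` in `X` is the edge `e`, then `X` has no two disjoint `s–t` carrying sets. -/
lemma not_kDisj_two_of_single_crossing (ends : E → Sym2 V) (S : Set V) {s t : V} (hs : s ∈ S)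
    (ht : t ∉ S) {X : Finset E} {e : E} (hX : ∀ f ∈ X, Crosses ends S f → f = e) :
    ¬ kDisj (fun T => Carries ends T s t) 2 X := by
  rintro ⟨K, L, hK, hL, hKL, hKc, hLc⟩
  have hKst : Carries ends K s t := hKc K le_rfl
  have hLst : Carries ends L s t :=
    (kDisj_one_iff (incr_carries ends s t) L).1 (hLc L le_rfl)
  obtain ⟨f₁, hf₁, hc₁, _⟩ := exists_crossing_of_carries ends S hs ht hKst
  obtain ⟨f₂, hf₂, hc₂, _⟩ := exists_crossing_of_carries ends S hs ht hLst
  have h₁ : f₁ = e := hX f₁ (hK hf₁) hc₁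
  have h₂ : f₂ = e := hX f₂ (hL hf₂) hc₂
  rw [h₁] at hf₁
  rw [h₂] at hf₂
  exact Finset.disjoint_left.1 hKL hf₁ hf₂

/-- a carrying set from `s ∈ S` to `t ∉ S` inside a set without crossing edges does not exist -/
lemma not_carries_of_no_crossing (ends : E → Sym2 V) (S : Set V) {s t : V} (hs : s ∈ S)
    (ht : t ∉ S) {X : Finset E} (hX : ∀ f ∈ X, ¬ Crosses ends S f) : ¬ Carries ends X s t := by
  intro h
  obtain ⟨f, hf, hc, _⟩ := exists_crossing_of_carries ends S hs ht h
  exact hX f hf hc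

open Classical in
/-- **the left side of the fibre slot bound has red flow `0`**: with the cut `C = U.filter (Crosses ends S)`
blue (`C ⊆ γ`), no pin and no inside edge crossing `S`, the red configuration `R ∪ (U ∖ γ)` carries no
`s–t` path. -/
theorem source_red_flow_zero (ends : E → Sym2 V) (s t : V) (O R U : Finset E) (S : Set V)
    (hs : s ∈ S) (ht : t ∉ S) (hO : ∀ e ∈ O, ¬ Crosses ends S e)
    (hR : ∀ e ∈ R, ∀ x ∈ ends e, x ∈ S) {γ : Finset E}
    (hC : U.filter (Crosses ends S) ⊆ γ) :
    ¬ pinFlow ends s t O 1 (R ∪ (U \ γ)) := by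
  rw [pinFlow_one_iff]
  show ¬ Carries ends (O ∪ (R ∪ (U \ γ))) s t
  refine not_carries_of_no_crossing ends S hs ht ?_
  intro f hf hc
  rcases Finset.mem_union.1 hf with h1 | h1
  · exact hO f h1 hc
  · rcases Finset.mem_union.1 h1 with h2 | h2
    · exact not_crosses_of_inside (hR f h2) hc
    · rw [Finset.mem_sdiff] at h2
      exact h2.2 (hC (Finset.mem_filter.2 ⟨h2.1, hc⟩))

open Classical in
/-- **the right side of the fibre slot bound has red flow exactly `1`**: if `S` is red-connected
inside through `R` (`s ⇝ u` in `O ∪ R` for every `u ∈ S`), the cut is blue except possibly `e`, and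
`O ∪ (U ∖ γ)` carries some vertex of `S` to `t`, then the red configuration `R ∪ (U ∖ γ)` has flow `≥ 1`
and not `≥ 2`. -/
theorem slot_red_flow_one (ends : E → Sym2 V) (s t : V) (O R U : Finset E) (S : Set V)
    (hs : s ∈ S) (ht : t ∉ S) (hO : ∀ e ∈ O, ¬ Crosses ends S e)
    (hR : ∀ e ∈ R, ∀ x ∈ ends e, x ∈ S) (hSconn : ∀ u ∈ S, Carries ends (O ∪ R) s u)
    {γ : Finset E} {e : E} (hCe : U.filter (Crosses ends S) \ {e} ⊆ γ)
    (hpath : ∃ u ∈ S, Carries ends (O ∪ (U \ γ)) u t) :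
    pinFlow ends s t O 1 (R ∪ (U \ γ)) ∧ ¬ pinFlow ends s t O 2 (R ∪ (U \ γ)) := by
  constructor
  · rw [pinFlow_one_iff]
    obtain ⟨u, hu, hcar⟩ := hpath
    have h1 : Carries ends (O ∪ (R ∪ (U \ γ))) s u :=
      (hSconn u hu).mono (by
        intro f hf
        rcases Finset.mem_union.1 hf with h | h
        · exact Finset.mem_union_left _ h
        · exact Finset.mem_union_right _ (Finset.mem_union_left _ h))
    have h2 : Carries ends (O ∪ (R ∪ (U \ γ))) u t :=
      hcar.mono (by
        intro f hf
        rcases Finset.mem_union.1 hf with h | h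
        · exact Finset.mem_union_left _ h
        · exact Finset.mem_union_right _ (Finset.mem_union_right _ h))
    exact conn_trans h1 h2
  · refine not_kDisj_two_of_single_crossing ends S hs ht (X := O ∪ (R ∪ (U \ γ))) (e := e) ?_
    intro f hf hc
    rcases Finset.mem_union.1 hf with h1 | h1
    · exact absurd hc (hO f h1)
    · rcases Finset.mem_union.1 h1 with h2 | h2
      · exact absurd hc (not_crosses_of_inside (hR f h2))
      · rw [Finset.mem_sdiff] at h2
        by_contra hne
        exact h2.2 (hCe (Finset.mem_sdiff.2 ⟨Finset.mem_filter.2 ⟨h2.1, hc⟩,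
          by rw [Finset.mem_singleton]; exact hne⟩))

/-- the blue flow of the full configuration `ζ ∪ γ` is the flow counted on the cube with the inside
edges as extra pins -/
lemma pinFlow_inside_union (ends : E → Sym2 V) (s t : V) (O ζ : Finset E) (k : ℕ) (γ : Finset E) :
    pinFlow ends s t (O ∪ ζ) k γ ↔ pinFlow ends s t O k (ζ ∪ γ) := by
  unfold pinFlow
  rw [Finset.union_assoc]

end StepZero

end Summit.Ventures.PercRepro2
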